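import Summits.HodgeConjecture.CorCM.Census.OcticTwistCover

/-!
# The octic twist `(ℤ/8 × B, (4,0))`, V: THE RESIDUAL PAIR TYPES — shape of `Φ₂ ≤ 1`, and AT LEAST TEN residual blocks (`|B| ≥ 3`)

COR-CM (cell `pub-hodgecm2`), count-neutral kernel combinatorics by the binder seat b09 (gen 33; lane COINVARIANT-TWIST / OCTIC RECON), on top of
parts I–IV (`Census/OcticTwist{Model,Motion,Reduction,Cover}.lean`: `Ty₂`, motions `act`, blocks `Orb₂`, the octic potential `pot`/`potOrb`,
`Phi_atom`, `Phi_cst`) and of the quartic clock model (`Census/QuarticTwistModel.lean`: `cst`, `atom`, `tw_cst`, `tw_atom`, `atom_apply`;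
`Census/QuarticTwistSquares.lean`: `L`, `Phi`, `lee`; `Census/QuarticTwistResidual.lean`: `atom_ne_cst`, `atom_eq_atom_iff` — atoms are
recognisable for `|B| ≥ 3`) used BY NAME.  Theorems only (no definition, no `decide` beyond closed numerals of `ZMod 4`,
no certificate, no named fact, no `sorry`).  HONEST FRAMING: `HC_CM` is NOT proved; nothing here is a period or a headline.

CONTENT (`|B| ≥ 3`).
* §1 **the pair types of potential `≤ 1` are exactly `(cst u, cst u′)`, `(cst u, u′ ± δ_b)`, `(u′ ± δ_b, cst u)`** (`exists_of_pot_le_one`;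
  `Φ = 0 ↔ constant`, `Φ = 1 ↔ ±1-atom`, from the Lee sums) — the support of the reduced vectors of part III/IV.
* §2–§3 **TEN pairwise non-equivalent residual pair types** (`|B| ≥ 3`): `(cst 0, cst d)` for `d ∈ {0, 1}` (the swap-twist acts on `d = u′ − u` by
  `d ↦ −d − 1`, so `{0,3}` and `{1,2}` are the two constant-constant blocks) and `(cst 0, r + kδ_{b₀})` for `k = ±1`, `r ∈ ℤ/4` (a motion fixing
  the shape `(cst, atom)` is diagonal and then fixes `r` and `k`; the swap-twist produces the shape `(atom, cst)`), whence
  **`10 ≤ #{ω : Orb₂ B | Φ₂(ω) ≤ 1}`** (`ten_le_card_residual_blocks`) — the number the count `|S| + 1 ≤ β` of the octic law needs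
  (`|S| ≤ #{Φ₂ ≥ 2} + 9` by parts IV and the nine closing faces of the lane note `HOME/pub-hodgecm2-b09/lean-g33/COINVARIANT-TWIST.md` FACT 3).
  (Numerically there are EXACTLY ten residual blocks for `|B| = 3, 4`; equality is not needed and not proved here.)

## References
* [Pohlmann1968] H. Pohlmann, Algebraic cycles on abelian varieties of complex multiplication type, Ann. of Math. 88 (1968), Thm 1.
* [Milne1999] J. S. Milne, Lefschetz motives and the Tate conjecture, Compositio Math. 117 (1999), Prop. 2.1, p. 54.
-/

namespace Summit.HodgeConjecture.CorCM.Census.OcticTwist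

open Finset
open Summit.HodgeConjecture.CorCM.Census.QuarticTwist

variable (B : Type) [AddGroup B] [Fintype B] [DecidableEq B]

/-! ## §1 The shape of the pair types of potential `≤ 1` -/

omit [AddGroup B] [DecidableEq B] in
/-- **`Φ(s) = 0 ↔ s` is constant.** [folklore] -/
theorem exists_cst_of_Phi_eq_zero {s : Ty B} (h : Phi B s = 0) : ∃ u : ZMod 4, s = cst B u := by
  obtain ⟨u, hu⟩ := exists_L_eq_Phi B s
  refine ⟨u, funext fun b => ?_⟩
  rw [h] at hu
  have hb : lee (s b - u) = 0 := by
    have := Finset.sum_eq_zero_iff.mp hu b (mem_univ b)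
    exact this
  exact sub_eq_zero.mp ((lee_eq_zero_iff _).mp hb)

omit [AddGroup B] in
/-- **`Φ(s) = 1 ⇒ s` is a `±1`-atom.** [folklore] -/
theorem exists_atom_of_Phi_eq_one' {s : Ty B} (h : Phi B s = 1) :
    ∃ (u : ZMod 4) (b : B) (k : ZMod 4), (k = 1 ∨ k = -1) ∧ s = atom B u b k := by
  obtain ⟨u, hu⟩ := exists_L_eq_Phi B s
  rw [h] at hu
  -- one column carries Lee weight 1, the others 0
  obtain ⟨b, _, hb⟩ : ∃ b ∈ (Finset.univ : Finset B), lee (s b - u) ≠ 0 := by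
    by_contra hall
    have hall' : ∀ x ∈ (Finset.univ : Finset B), lee (s x - u) = 0 := fun x hx => by
      by_contra hne
      exact hall ⟨x, hx, hne⟩
    have : L B u s = 0 := Finset.sum_eq_zero hall'
    omega
  have hsplit := L_eq_add_erase B u s b
  rw [hu] at hsplit
  have hb1 : lee (s b - u) = 1 := by omega
  have hrest : ∑ x ∈ univ.erase b, lee (s x - u) = 0 := by omega
  refine ⟨u, b, s b - u, (lee_eq_one_iff _).mp hb1, funext fun x => ?_⟩
  rw [atom_apply]
  by_cases hx : x = b
  · rw [if_pos hx, hx]; ring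
  · rw [if_neg hx]
    have h0 := Finset.sum_eq_zero_iff.mp hrest x (Finset.mem_erase.mpr ⟨hx, mem_univ x⟩)
    exact sub_eq_zero.mp ((lee_eq_zero_iff _).mp h0)

omit [AddGroup B] in
/-- **THE RESIDUAL PAIR TYPES**: a pair type of octic potential `≤ 1` is `(cst u, cst u′)`, `(cst u, atom)` or `(atom, cst u)` with a
`±1`-atom. [folklore] -/
theorem exists_of_pot_le_one {T : Ty₂ B} (hT : pot B T ≤ 1) :
    (∃ u u' : ZMod 4, T = (cst B u, cst B u')) ∨
    (∃ (u u' : ZMod 4) (b : B) (k : ZMod 4), (k = 1 ∨ k = -1) ∧ (T = (cst B u, atom B u' b k) ∨ T = (atom B u' b k, cst B u))) := by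
  obtain ⟨s, t⟩ := T
  rw [pot_mk] at hT
  rcases Nat.eq_zero_or_pos (Phi B s) with hs | hs
  · obtain ⟨u, rfl⟩ := exists_cst_of_Phi_eq_zero B hs
    rcases Nat.eq_zero_or_pos (Phi B t) with ht | ht
    · obtain ⟨u', rfl⟩ := exists_cst_of_Phi_eq_zero B ht
      exact Or.inl ⟨u, u', rfl⟩
    · obtain ⟨u', b, k, hk, rfl⟩ := exists_atom_of_Phi_eq_one' B (show Phi B t = 1 by omega)
      exact Or.inr ⟨u, u', b, k, hk, Or.inl rfl⟩
  · have ht : Phi B t = 0 := by omega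
    obtain ⟨u, rfl⟩ := exists_cst_of_Phi_eq_zero B ht
    obtain ⟨u', b, k, hk, rfl⟩ := exists_atom_of_Phi_eq_one' B (show Phi B s = 1 by omega)
    exact Or.inr ⟨u, u', b, k, hk, Or.inr rfl⟩

/-! ## §2 Motions of the residual shapes -/

omit [Fintype B] [DecidableEq B] in
/-- A motion of a constant-constant type is constant-constant: `act e h (cst a, cst a′)`. [folklore] -/
theorem act_cst_cst (e : Bool) (h : ZMod 4 × B) (a a' : ZMod 4) :
    act B e h (cst B a, cst B a') = if e then (cst B (a' + 1 + h.1), cst B (a + h.1)) else (cst B (a + h.1), cst B (a' + h.1)) := by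
  cases e
  · rw [act_false]
    show (tw B h (cst B a), tw B h (cst B a')) = _
    rw [tw_cst, tw_cst]
    rfl
  · rw [act_true]
    show (tw B h (tw B (1, 0) (cst B a')), tw B h (cst B a)) = _
    rw [tw_cst, tw_cst, tw_cst]
    rfl

omit [Fintype B] in
/-- A motion of a constant-atom type: diagonal ones keep the shape, the swap-twist exchanges it. [folklore] -/
theorem act_cst_atom (e : Bool) (h : ZMod 4 × B) (a r : ZMod 4) (b : B) (k : ZMod 4) :
    act B e h (cst B a, atom B r b k) =
      if e then (atom B (r + 1 + h.1) (b - h.2) k, cst B (a + h.1)) else (cst B (a + h.1), atom B (r + h.1) (b - h.2) k) := by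
  cases e
  · rw [act_false]
    show (tw B h (cst B a), tw B h (atom B r b k)) = _
    rw [tw_cst, tw_atom]
    rfl
  · rw [act_true]
    show (tw B h (tw B (1, 0) (atom B r b k)), tw B h (cst B a)) = _
    rw [tw_atom, tw_atom, tw_cst, sub_zero]
    rfl

omit [Fintype B] [DecidableEq B] in
/-- **The two constant-constant blocks**: `(cst 0, cst 0)` and `(cst 0, cst 1)` are not in one block (`B` non-empty). [folklore] -/
theorem not_rel_cst_cst [Nonempty B] : ¬ (orbitRel₂ B).r (cst B 0, cst B 0) (cst B 0, cst B 1) := by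
  rintro ⟨e, h, hact⟩
  rw [act_cst_cst] at hact
  obtain ⟨b⟩ := ‹Nonempty B›
  cases e
  · simp only [if_false, Bool.false_eq_true] at hact
    have h1 := congrFun (Prod.ext_iff.mp hact).1 b
    have h2 := congrFun (Prod.ext_iff.mp hact).2 b
    simp only [cst, zero_add] at h1 h2
    rw [h1] at h2
    exact absurd h2 (by decide)
  · simp only [if_true] at hact
    have h1 := congrFun (Prod.ext_iff.mp hact).1 b
    have h2 := congrFun (Prod.ext_iff.mp hact).2 b
    simp only [cst, zero_add] at h1 h2
    rw [h2] at h1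
    exact absurd h1 (by decide)

/-- A constant-constant type and a constant-atom type are not in one block (`|B| ≥ 3`, `k ≠ 0`). [folklore] -/
theorem not_rel_cst_cst_cst_atom (h3 : 3 ≤ Fintype.card B) (d r : ZMod 4) (b : B) {k : ZMod 4} (hk : k ≠ 0) :
    ¬ (orbitRel₂ B).r (cst B 0, cst B d) (cst B 0, atom B r b k) := by
  rintro ⟨e, h, hact⟩
  rw [act_cst_cst] at hact
  cases e
  · simp only [if_false, Bool.false_eq_true] at hact
    exact atom_ne_cst B h3 hk _ (Prod.ext_iff.mp hact).2.symm
  · simp only [if_true] at hact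
    exact atom_ne_cst B h3 hk _ (Prod.ext_iff.mp hact).2.symm

/-- **The eight constant-atom blocks**: `(cst 0, r + kδ_b)` and `(cst 0, r′ + k′δ_b)` (`k, k′ ≠ 0`) are in one block only if `r = r′` and
`k = k′` (`|B| ≥ 3`). [folklore] -/
theorem eq_of_rel_cst_atom (h3 : 3 ≤ Fintype.card B) {r r' : ZMod 4} (b : B) {k k' : ZMod 4} (hk : k ≠ 0)
    (hrel : (orbitRel₂ B).r (cst B 0, atom B r b k) (cst B 0, atom B r' b k')) : r = r' ∧ k = k' := by
  obtain ⟨e, h, hact⟩ := hrel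
  rw [act_cst_atom] at hact
  cases e
  · simp only [if_false, Bool.false_eq_true] at hact
    obtain ⟨h1, h2⟩ := Prod.ext_iff.mp hact
    obtain ⟨x⟩ : Nonempty B := ⟨b⟩
    have hv : h.1 = 0 := by
      have := congrFun h1 x
      simp only [cst] at this
      simpa using this
    simp only [hv, add_zero] at h2
    obtain ⟨hr, -, hkk⟩ := (atom_eq_atom_iff B h3 hk).mp h2
    exact ⟨hr, hkk⟩
  · simp only [if_true] at hact
    exact absurd (Prod.ext_iff.mp hact).1 (atom_ne_cst B h3 hk 0)

/-! ## §3 At least ten residual blocks -/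

omit [AddGroup B] in
/-- The potential of a constant-constant type is `0` (`|B| ≥ 3`). [folklore] -/
theorem pot_cst_cst (h3 : 3 ≤ Fintype.card B) (b : B) (a a' : ZMod 4) : pot B (cst B a, cst B a') = 0 := by
  rw [pot_mk, Phi_cst B h3 a b, Phi_cst B h3 a' b]

omit [AddGroup B] in
/-- The potential of a constant-(`±1`-atom) type is `1` (`|B| ≥ 3`). [folklore] -/
theorem pot_cst_atom (h3 : 3 ≤ Fintype.card B) (a r : ZMod 4) (b : B) {k : ZMod 4} (hk : k = 1 ∨ k = -1) :
    pot B (cst B a, atom B r b k) = 1 := by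
  rw [pot_mk, Phi_cst B h3 a b, Phi_atom B h3, (lee_eq_one_iff k).mpr hk]

/-- **AT LEAST TEN RESIDUAL BLOCKS** (`|B| ≥ 3`): the blocks of `(cst 0, cst d)`, `d ∈ {0,1}`, and of `(cst 0, r ± δ_b)`, `r ∈ ℤ/4`, are ten
distinct blocks of octic potential `≤ 1`. [folklore] -/
theorem ten_le_card_residual_blocks (h3 : 3 ≤ Fintype.card B) : 10 ≤ Fintype.card {ω : Orb₂ B // potOrb B ω ≤ 1} := by
  classical
  obtain ⟨b⟩ : Nonempty B := Fintype.card_pos_iff.mp (by omega)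
  -- the ten representatives, indexed by `Bool ⊕ (Bool × ZMod 4)`
  let sgn : Bool → ZMod 4 := fun ε => if ε then 1 else -1
  have hsgn : ∀ ε, sgn ε = 1 ∨ sgn ε = -1 := fun ε => by cases ε <;> simp [sgn]
  have hsgn0 : ∀ ε, sgn ε ≠ 0 := fun ε => by cases ε <;> decide
  let rep : Bool ⊕ (Bool × ZMod 4) → Ty₂ B := fun i =>
    match i with
    | Sum.inl d => (cst B 0, cst B (if d then 1 else 0))
    | Sum.inr (ε, r) => (cst B 0, atom B r b (sgn ε))
  have hpot : ∀ i, pot B (rep i) ≤ 1 := by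
    rintro (d | ⟨ε, r⟩)
    · show pot B (cst B 0, cst B _) ≤ 1
      rw [pot_cst_cst B h3 b]; omega
    · show pot B (cst B 0, atom B r b (sgn ε)) ≤ 1
      rw [pot_cst_atom B h3 0 r b (hsgn ε)]
  let f : Bool ⊕ (Bool × ZMod 4) → {ω : Orb₂ B // potOrb B ω ≤ 1} := fun i =>
    ⟨Quotient.mk (orbitRel₂ B) (rep i), by rw [potOrb_mk]; exact hpot i⟩
  have hf : Function.Injective f := by
    rintro (d | ⟨ε, r⟩) (d' | ⟨ε', r'⟩) h
    · have hrel : (orbitRel₂ B).r (rep (Sum.inl d)) (rep (Sum.inl d')) := Quotient.exact (congrArg Subtype.val h)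
      cases d <;> cases d'
      · rfl
      · exact absurd hrel (not_rel_cst_cst B)
      · exact absurd ((orbitRel₂ B).symm hrel) (not_rel_cst_cst B)
      · rfl
    · have hrel : (orbitRel₂ B).r (rep (Sum.inl d)) (rep (Sum.inr (ε', r'))) := Quotient.exact (congrArg Subtype.val h)
      exact absurd hrel (not_rel_cst_cst_cst_atom B h3 _ r' b (hsgn0 ε'))
    · have hrel : (orbitRel₂ B).r (rep (Sum.inr (ε, r))) (rep (Sum.inl d')) := Quotient.exact (congrArg Subtype.val h)
      exact absurd ((orbitRel₂ B).symm hrel) (not_rel_cst_cst_cst_atom B h3 _ r b (hsgn0 ε))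
    · have hrel : (orbitRel₂ B).r (rep (Sum.inr (ε, r))) (rep (Sum.inr (ε', r'))) := Quotient.exact (congrArg Subtype.val h)
      obtain ⟨hr, hk⟩ := eq_of_rel_cst_atom B h3 b (hsgn0 ε) hrel
      have hε : ε = ε' := by
        revert hk
        cases ε <;> cases ε' <;> simp [sgn] <;> decide
      rw [hr, hε]
  have hcard := Fintype.card_le_of_injective f hf
  simpa using hcard

end Summit.HodgeConjecture.CorCM.Census.OcticTwist
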